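import Mathlib
import HarnessLib
import Summits.Langlands.Langlands.Statement
import Literature.NumberTheory.GaloisRepresentations.TateTwistFrobeniusProofs

/-!
# The unramified twist dictionary at one place (crux stmt-Langlands-15111, line Sketch, stub
`stub_twistDictionaryAt`) — helper file (`--supports`), odd-descent-up-to-twist sector (c15)

Let `π, π'` be automorphic representations of `GL_2(𝔸_K)`, `σ₀ : Γ_K →ₜ* GL_2(ℚ̄_p)` a framed
Galois representation, `ψ : Γ_K →ₜ* ℚ̄_pˣ` a continuous character, `w` a finite place of `K` and
`z : ℂ`.  Suppose

* every Satake parameter `α` of `π` at `w` gives the Satake parameter `z · α` of `π'` at `w`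
  (`π' = π ⊗ ω` with `ω(ϖ_w) = z`);
* `ψ` is trivial on the inertia groups above `w` and takes the constant value `ι⁻¹(z⁻¹)` on the
  arithmetic Frobenii above `w`;
* `π` is Satake–Frobenius compatible with `σ₀` at `w` (`Summit.Langlands.SatakeFrobCompatibleAt`,
  arithmetic normalisation `m = 1`: the arithmetic Frobenius has characteristic polynomial
  `∏_j (X - ι⁻¹(α_j⁻¹))`, `arithFrobPolyOfSatake ι q_w 1 α`).

Then `π'` is Satake–Frobenius compatible with the twist `σ₀ ⊗ ψ` at `w`: the twist is unramified
at `w` (`FramedGaloisRep.isUnramifiedAt_twist`) and its arithmetic Frobenii have characteristic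
polynomial `∏_j (X - ι⁻¹(z⁻¹) ι⁻¹(α_j⁻¹)) = ∏_j (X - ι⁻¹((z α_j)⁻¹))`
(`FramedGaloisRep.hasFrobCharpolyAt_twist_of_eq_prod`, `mul_inv`, `map_mul`), which is
`arithFrobPolyOfSatake ι q_w 1 (z · α)`.

* `arithFrobPolyOfSatake_one_eq_prod_map` — `arithFrobPolyOfSatake ι q 1 α` as
  `∏_{b ∈ β} (X - b)` with `β = α.map (ι⁻¹ ∘ (·)⁻¹)`.
* `arithFrobPolyOfSatake_one_map_mul` — `arithFrobPolyOfSatake ι q 1 (z · α) =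
  ∏_{b ∈ β} (X - ι⁻¹(z⁻¹) b)`.
* `stub_twistDictionaryAt` — the statement displayed above (header = the registered signature).

No definitions.
-/

noncomputable section

open scoped NumberField Polynomial Classical
open IsDedekindDomain Field Polynomial
open Literature.NumberTheory.Automorphic Literature.NumberTheory.GaloisRepresentations

-- `Summit.Langlands.Langlands.…`: summit = sub-problem name (D-0017 nested layout), not a typo.
set_option linter.dupNamespace false

namespace Summit.Langlands.Langlands.Theorems.ArtinWeightRealisationLevel

/-- `arithFrobPolyOfSatake ι q 1 α = ∏_{b ∈ β} (X - b)` with `β = α.map fun a ↦ ι⁻¹(a⁻¹)`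
(`arithFrobPolyOfSatake_one` and `Multiset.map_map`). [folklore] -/
theorem arithFrobPolyOfSatake_one_eq_prod_map {p : ℕ} [Fact p.Prime] (ι : PadicAlgCl p ≃+* ℂ)
    (q : ℕ) (α : Multiset ℂ) :
    arithFrobPolyOfSatake ι q 1 α =
      ((α.map fun a ↦ ι.symm a⁻¹).map fun b ↦ X - C b).prod := by
  rw [arithFrobPolyOfSatake_one, Multiset.map_map]
  rfl

/-- `arithFrobPolyOfSatake ι q 1 (z · α) = ∏_{b ∈ β} (X - ι⁻¹(z⁻¹) b)` with
`β = α.map fun a ↦ ι⁻¹(a⁻¹)`: termwise `ι⁻¹((z a)⁻¹) = ι⁻¹(z⁻¹) ι⁻¹(a⁻¹)` (`mul_inv` in the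
field `ℂ`, `map_mul`). [folklore] -/
theorem arithFrobPolyOfSatake_one_map_mul {p : ℕ} [Fact p.Prime] (ι : PadicAlgCl p ≃+* ℂ)
    (q : ℕ) (α : Multiset ℂ) (z : ℂ) :
    arithFrobPolyOfSatake ι q 1 (α.map (z * ·)) =
      ((α.map fun a ↦ ι.symm a⁻¹).map fun b ↦ X - C (ι.symm z⁻¹ * b)).prod := by
  rw [arithFrobPolyOfSatake_one, Multiset.map_map, Multiset.map_map]
  congr 1
  refine Multiset.map_congr rfl fun a _ => ?_
  simp only [Function.comp_apply, mul_inv, map_mul]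

/-- **The unramified twist dictionary at `w`.**  If `π` is Satake–Frobenius compatible with `σ₀`
at `w` (arithmetic normalisation `m = 1`), `ψ` is trivial on the inertia groups above `w` with
constant value `ι⁻¹(z⁻¹)` on the arithmetic Frobenii above `w`, and the Satake parameters of `π'`
at `w` are `z` times those of `π`, then `π'` is Satake–Frobenius compatible with `σ₀ ⊗ ψ` at `w`:
witness `z · α`; unramifiedness by `FramedGaloisRep.isUnramifiedAt_twist`; the Frobenius
characteristic polynomial by `FramedGaloisRep.hasFrobCharpolyAt_twist_of_eq_prod` with
`c = ι⁻¹(z⁻¹)` and `arithFrobPolyOfSatake_one_map_mul`.  (Header = the signature registered on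
the crux item, verbatim.) [folklore] -/
theorem stub_twistDictionaryAt : ∀ (K : Type) [Field K] [NumberField K] (p : ℕ) [Fact p.Prime] (ι : PadicAlgCl p ≃+* ℂ) (hcpt : Literature.NumberTheory.Automorphic.isCompact_glFiniteIntegralLevel 2 K) (π π' : Literature.NumberTheory.Automorphic.AutomorphicRepData (Literature.NumberTheory.Automorphic.AutomorphyDatum.gl 2 K hcpt)) (σ₀ : Literature.NumberTheory.GaloisRepresentations.FramedGaloisRep K (PadicAlgCl p) 2) (ψ : Field.absoluteGaloisGroup K →ₜ* (PadicAlgCl p)ˣ) (w : IsDedekindDomain.HeightOneSpectrum (NumberField.RingOfIntegers K)) (z : ℂ), (∀ α : Multiset ℂ, π.HasSatakeParamAt w α → π'.HasSatakeParamAt w (α.map (z * ·))) → (∀ 𝔓 ∈ w.primesAbove, ∀ g ∈ 𝔓.inertia (Field.absoluteGaloisGroup K), ψ g = 1) → (∀ 𝔓 ∈ w.primesAbove, ∀ Φ : Field.absoluteGaloisGroup K, IsArithFrobAt (NumberField.RingOfIntegers K) Φ 𝔓 → ((ψ Φ : (PadicAlgCl p)ˣ) : PadicAlgCl p) = ι.symm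 (z⁻¹)) → Summit.Langlands.SatakeFrobCompatibleAt ι π σ₀ w → Summit.Langlands.SatakeFrobCompatibleAt ι π' (Literature.NumberTheory.GaloisRepresentations.FramedRep.twist σ₀ ψ) w := by
  rintro K _ _ p _ ι hcpt π π' σ₀ ψ w z hS hI hF ⟨α, hα, hunr, hchar⟩
  refine ⟨α.map (z * ·), hS α hα, FramedGaloisRep.isUnramifiedAt_twist hunr hI, ?_⟩
  rw [arithFrobPolyOfSatake_one_eq_prod_map] at hchar
  rw [arithFrobPolyOfSatake_one_map_mul]
  exact FramedGaloisRep.hasFrobCharpolyAt_twist_of_eq_prod hchar hF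

end Summit.Langlands.Langlands.Theorems.ArtinWeightRealisationLevel

end
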